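import Mathlib
import Summits.Ventures.PercRepro2.TypedBundleSepTwo
import Summits.Ventures.PercRepro2.SevenTypedDomAll

/-!
# The domain of record at `|F| ≥ 8` (blind cell PercRepro2, p2 g6 / g7, 2026-08-25/26; sub-claim S1 —
night-3 g9's domain-restricted rung `|F| = 7` composed on the sixteen-condition layer; the lead's
R-RUNG7 (b))

night-3 g9's `TwoTyped.typedCount_nonneg_of_domain_card_seven` (SevenTypedDomAll.lean: row 2′TRI on every
instance of `ResidualCoreNHatCTBRASUDO` with exactly seven typed edges — the ladder's per-leaf tests on the
reduced sorted labellings restricted by a label / state guard) closes the `|F| = 7` instances of the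
sixteen-condition domain, so the domain drops to `|F| ≥ 8`, in the `by_cases` pattern of every layer:

* **`ResidualCoreNHatCTBRASUDO7SP2E := ResidualCoreNHatCTBRASUDO7SP2 ∧ 8 ≤ |F|`**,
  **`HCov_all_of_residualCoreNHatCTBRASUDO7SP2E_all`** — UNCONDITIONAL;
* the flat form **`FlatDomain8_all`** (the sixteen conditions of `FlatDomain7SP2_all` with `7 ≤ F.card`
  sharpened to `8 ≤ F.card`), **`HCov_all_of_flat8_all`**.

Own code; standard axioms.
-/

namespace Summit.Ventures.PercRepro2

open UnionCluster

namespace CovForm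

namespace TypedRed

section CoreEight

variable {V : Type*} {E : Type*} [DecidableEq V] [Fintype E] [DecidableEq E]

/-- **The domain of record at `|F| ≥ 8`.** -/
structure ResidualCoreNHatCTBRASUDO7SP2E (ends : E → Sym2 V) (o a₁ a₂ a₃ b : V) (F : Finset E) :
    Prop where
  coreNHatCTBRASUDO7SP2 : ResidualCoreNHatCTBRASUDO7SP2 ends o a₁ a₂ a₃ b F
  eight_le : 8 ≤ F.card

end CoreEight

section ClosureEight

variable (R : Type*) [Field R] [LinearOrder R] [IsStrictOrderedRing R]

/-- **Row 2′TRI on `ResidualCoreNHatCTBRASUDO7SP2E`, over every finite graph.** -/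
def ResidualCoreNHatCTBRASUDO7SP2E_all : Prop :=
  ∀ (V E : Type) [Fintype V] [DecidableEq V] [Fintype E] [DecidableEq E]
    (ends : E → Sym2 V) (o a₁ a₂ a₃ b : V) (F : Finset E) (τ : E → ℕ),
    (∀ e ∈ F, τ e = 1 ∨ τ e = 2) → ResidualCoreNHatCTBRASUDO7SP2E ends o a₁ a₂ a₃ b F →
      0 ≤ typedCount F (fun _ => false) τ
        (K3 ends o a₁ a₂ a₃ b : Config E → Config E → Config E → R)

/-- **THE CRUX OF RECORD FROM (TRI) ON THE DOMAIN OF RECORD AT `|F| ≥ 8`** — unconditional (the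
sixteen-condition layer and night-3's domain-restricted rung `|F| = 7`). -/
theorem HCov_all_of_residualCoreNHatCTBRASUDO7SP2E_all (hc : ResidualCoreNHatCTBRASUDO7SP2E_all R) :
    HCov_all R := by
  refine HCov_all_of_residualCoreNHatCTBRASUDO7SP2_all R ?_
  intro V E _ _ _ _ ends o a₁ a₂ a₃ b F τ hτ hdom
  by_cases h7 : F.card = 7
  · exact TwoTyped.typedCount_nonneg_of_domain_card_seven ends o a₁ a₂ a₃ b F
      hdom.coreNHatCTBRASUDO7SP.coreNHatCTBRASUDO7S.coreNHatCTBRASUDO7.coreNHatCTBRASUDO h7 τ hτ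
  · have h8 : 8 ≤ F.card := by
      have := hdom.coreNHatCTBRASUDO7SP.coreNHatCTBRASUDO7S.coreNHatCTBRASUDO7.seven_le
      omega
    exact hc V E ends o a₁ a₂ a₃ b F τ hτ ⟨hdom, h8⟩

/-- **Row 2′TRI on the flat domain at `|F| ≥ 8`, over every finite graph** (the sixteen conditions,
`8 ≤ F.card` in place of `7 ≤ F.card`). -/
def FlatDomain8_all : Prop :=
  ∀ (V E : Type) [Fintype V] [DecidableEq V] [Fintype E] [DecidableEq E]
    (ends : E → Sym2 V) (o a₁ a₂ a₃ b : V) (F : Finset E) (τ : E → ℕ),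
    (∀ e ∈ F, τ e = 1 ∨ τ e = 2) →
    ResidualCore ends o a₁ a₂ a₃ b F →
    ¬ Hats ends o a₁ a₂ a₃ b F →
    ¬ HasRootCut ends o a₁ a₂ a₃ b F →
    ¬ HasTwoTerminalPart ends o a₁ a₂ a₃ b F →
    ¬ HasRootBundle ends o a₁ a₂ a₃ b F →
    ¬ RootBridge.HasCutRoots ends o a₁ a₂ a₃ b F →
    ¬ RootBridge.HasCutRootsA3 ends o a₁ a₂ a₃ b F →
    ¬ OneStar ends o a₁ a₂ a₃ b F →
    ¬ RootBridge.MildInst ends o a₁ a₂ a₃ b F (fun _ => false) →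
    o ≠ b →
    ¬ RootBridge.OBehindA3 ends o a₁ a₂ a₃ F (fun _ => false) →
    8 ≤ F.card →
    ¬ SepThree.HasSepThree ends o a₁ a₂ a₃ b F →
    ¬ SepThree.HasSepThree ends o a₂ a₁ a₃ b F →
    ¬ PocketAB.HasPocketAB ends o a₁ a₂ a₃ b F →
    ¬ SepTwo.HasSepTwo ends o a₁ a₂ a₃ b F →
      0 ≤ typedCount F (fun _ => false) τ
        (K3 ends o a₁ a₂ a₃ b : Config E → Config E → Config E → R)

/-- **THE CRUX OF RECORD FROM (TRI) ON THE FLAT DOMAIN AT `|F| ≥ 8`** — the sentence of record in one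
statement (sixteen conditions, `8 ≤ F.card`). -/
theorem HCov_all_of_flat8_all (hc : FlatDomain8_all R) : HCov_all R := by
  refine HCov_all_of_residualCoreNHatCTBRASUDO7SP2E_all R ?_
  intro V E _ _ _ _ ends o a₁ a₂ a₃ b F τ hτ hdom
  obtain ⟨h0, h1, h2, h3, h4, h5, h6, h7, h8, h9, h10⟩ :=
    (ResidualCoreNHatCTBRASUDO_iff ends o a₁ a₂ a₃ b F).1
      hdom.coreNHatCTBRASUDO7SP2.coreNHatCTBRASUDO7SP.coreNHatCTBRASUDO7S.coreNHatCTBRASUDO7.coreNHatCTBRASUDO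
  exact hc V E ends o a₁ a₂ a₃ b F τ hτ h0 h1 h2 h3 h4 h5 h6 h7 h8 h9 h10 hdom.eight_le
    hdom.coreNHatCTBRASUDO7SP2.coreNHatCTBRASUDO7SP.coreNHatCTBRASUDO7S.not_sepThree
    hdom.coreNHatCTBRASUDO7SP2.coreNHatCTBRASUDO7SP.coreNHatCTBRASUDO7S.not_sepThree_mirror
    hdom.coreNHatCTBRASUDO7SP2.coreNHatCTBRASUDO7SP.not_pocketAB hdom.coreNHatCTBRASUDO7SP2.not_sepTwo

end ClosureEight

end TypedRed

end CovForm

end Summit.Ventures.PercRepro2
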